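import Mathlib
import Literature.Probability.Moments.AnalyticCharFunExponentialMoments
import HarnessLib

/-!
# Cone of disc sections (stub `stub_coneOfDiscSections`, crux `PencilRigidity.ShellRigidity`,
line `transverse-smearing-planar-threshold`, stmt-QuantumFields-11685)

Informal statement. Let `μ` be a finite measure on `ℝ⁴` (energy–momentum variables `p₀ = p 0`,
`p₁ = p 1`) with `μ {p₀ < 0} = 0`, and suppose that for every `t > 0` the function
`b ↦ ∫ e^{-t p₀ + i b p₁} dμ` on `(-t, t)` is the restriction of a function holomorphic on the disc
`|z| < t` and bounded there by a `t`-uniform constant `M`. Then `μ {p₀ < |p₁|} = 0`: the measure is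
carried by the forward light cone, with speed of light exactly `1` because the radius is exactly
`t`.

Proof ("analytic characteristic function ⇒ exponential moments ⇒ cone"). For fixed `t > 0` the
weighted law `ν_t` of `p₁` under `e^{-t p₀} μ` (Mathlib: `Measure.map (· 1) (μ.withDensity _)`) is a
finite measure on `ℝ` whose characteristic function is `b ↦ ∫ e^{-t p₀ + i b p₁} dμ`; by Lukacs'
theorem on analytic characteristic functions in the sharp Landau–Pringsheim form
(`Literature.Probability.Moments.lintegral_exp_mul_le_of_charFun_eq`: E. Lukacs, *Characteristic
functions*, 2nd ed. 1970, Thm. 7.1.1) `∫ e^{σ x} dν_t ≤ M` for `|σ| < t`, i.e.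
`∫ e^{σ p₁ - t p₀} dμ ≤ M` (`ConeOfDiscSections.lintegral_exp_le`). Along the rays `t = Y + 1`,
`σ = ±Y` the left-hand side dominates `e^{δ Y - L} μ {0 ≤ p₀ ≤ L, p₀ + δ < |p₁|}`, so letting
`Y → ∞` these gap sets are null (`ConeOfDiscSections.measure_gapSet_eq_zero`), and `{p₀ < |p₁|}`
is covered by `{p₀ < 0}` and countably many gap sets (`stub_coneOfDiscSections`).

This statement is verbatim the registered stub `stub_cone_of_discSections` of the sibling crux
`MirrorModularBoosts.PlanarSpectralCone` (stmt-QuantumFields-9664). No definitions.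
-/

noncomputable section

namespace Summit.QuantumFields.YangMills.Cruxes.ShellRigidity.TransverseSmearingPlanarThreshold

open MeasureTheory Complex Set Filter Metric
open scoped Topology ENNReal NNReal

namespace ConeOfDiscSections

/-- The coordinates of `ℝ⁴` are measurable. -/
theorem measurable_coord (i : Fin 4) : Measurable fun p : EuclideanSpace ℝ (Fin 4) => p i :=
  (by fun_prop : Continuous fun p : EuclideanSpace ℝ (Fin 4) => p i).measurable

/-- Measurability of the exponential integrands `p ↦ e^{a p₁ - c p₀}` (as `ℝ≥0∞`-valued maps). -/
theorem measurable_ofReal_exp (a c : ℝ) :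
    Measurable fun p : EuclideanSpace ℝ (Fin 4) => ENNReal.ofReal (Real.exp (a * p 1 - c * p 0)) :=
  ENNReal.measurable_ofReal.comp
    (by fun_prop : Continuous fun p : EuclideanSpace ℝ (Fin 4) =>
      Real.exp (a * p 1 - c * p 0)).measurable

/-- **Exponential moments from a disc section** (Lukacs / Landau–Pringsheim, transported to the
weighted law of `p₁`). If `μ {p₀ < 0} = 0` and `b ↦ ∫ e^{-t p₀ + i b p₁} dμ` agrees on `(-t, t)`
with a function `f` holomorphic on the disc `|z| < t` and bounded there by `M`, then
`∫ e^{σ p₁ - t p₀} dμ ≤ M` for every `|σ| < t`. -/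
theorem lintegral_exp_le (μ : Measure (EuclideanSpace ℝ (Fin 4))) [IsFiniteMeasure μ]
    (hE : μ {p | p 0 < 0} = 0) {M t : ℝ} (ht : 0 < t) {f : ℂ → ℂ}
    (hf : DifferentiableOn ℂ f (ball 0 t)) (hM : ∀ z ∈ ball (0 : ℂ) t, ‖f z‖ ≤ M)
    (hrep : ∀ b : ℝ, |b| < t →
      f b = ∫ p, cexp (((-(t * p 0) : ℝ) : ℂ) + ((b * p 1 : ℝ) : ℂ) * I) ∂μ)
    {σ : ℝ} (hσ : |σ| < t) :
    ∫⁻ p, ENNReal.ofReal (Real.exp (σ * p 1 - t * p 0)) ∂μ ≤ ENNReal.ofReal M := by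
  -- the density `e^{-t p₀}` and the weighted law of `p₁`
  obtain ⟨d, hd⟩ : ∃ d : EuclideanSpace ℝ (Fin 4) → ℝ≥0∞,
      d = fun p => ENNReal.ofReal (Real.exp (-(t * p 0))) := ⟨_, rfl⟩
  have hd_meas : Measurable d := by
    rw [hd]
    exact ENNReal.measurable_ofReal.comp
      (by fun_prop : Continuous fun p : EuclideanSpace ℝ (Fin 4) =>
        Real.exp (-(t * p 0))).measurable
  have hae : ∀ᵐ p ∂μ, 0 ≤ p 0 := by
    rw [ae_iff]
    simpa only [not_le] using hE
  have hd_le : ∀ᵐ p ∂μ, d p ≤ 1 := by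
    refine hae.mono fun p hp => ?_
    simp only [hd]
    rw [ENNReal.ofReal_le_one, Real.exp_le_one_iff, neg_nonpos]
    exact mul_nonneg ht.le hp
  have hd_fin : ∫⁻ p, d p ∂μ ≠ ∞ := by
    refine ne_top_of_le_ne_top (measure_ne_top μ univ) ?_
    calc ∫⁻ p, d p ∂μ ≤ ∫⁻ _, 1 ∂μ := lintegral_mono_ae hd_le
      _ = μ univ := lintegral_one
  haveI : IsFiniteMeasure (μ.withDensity d) := isFiniteMeasure_withDensity hd_fin
  -- its characteristic function is the given integral
  have hchar : ∀ b : ℝ,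
      charFun ((μ.withDensity d).map fun p : EuclideanSpace ℝ (Fin 4) => p 1) b =
        ∫ p, cexp (((-(t * p 0) : ℝ) : ℂ) + ((b * p 1 : ℝ) : ℂ) * I) ∂μ := by
    intro b
    rw [charFun_apply_real, integral_map (measurable_coord 1).aemeasurable
        (by fun_prop : Continuous fun x : ℝ => cexp (↑b * ↑x * I)).aestronglyMeasurable,
      integral_withDensity_eq_integral_toReal_smul hd_meas
        (Eventually.of_forall fun p => by rw [hd]; exact ENNReal.ofReal_lt_top)]
    refine integral_congr_ae (Eventually.of_forall fun p => ?_)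
    simp only [hd]
    rw [ENNReal.toReal_ofReal (Real.exp_pos _).le, Complex.real_smul, Complex.ofReal_exp,
      ← Complex.exp_add]
    congr 1
    push_cast
    ring
  have hfν : ∀ b : ℝ, |b| < t →
      f b = charFun ((μ.withDensity d).map fun p : EuclideanSpace ℝ (Fin 4) => p 1) b :=
    fun b hb => (hrep b hb).trans (hchar b).symm
  -- Lukacs / Landau–Pringsheim for the weighted law, transported back to `μ`
  have key := Literature.Probability.Moments.lintegral_exp_mul_le_of_charFun_eq
    ((μ.withDensity d).map fun p : EuclideanSpace ℝ (Fin 4) => p 1) ht hf hM hfν hσ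
  have hg : Measurable fun x : ℝ => ENNReal.ofReal (Real.exp (σ * x)) :=
    ENNReal.measurable_ofReal.comp
      (by fun_prop : Continuous fun x : ℝ => Real.exp (σ * x)).measurable
  rw [lintegral_map hg (measurable_coord 1),
    lintegral_withDensity_eq_lintegral_mul μ hd_meas
      (g := fun p : EuclideanSpace ℝ (Fin 4) => ENNReal.ofReal (Real.exp (σ * p 1)))
      (hg.comp (measurable_coord 1))] at key
  refine le_trans (le_of_eq (lintegral_congr fun p => ?_)) key
  simp only [Pi.mul_apply, hd]
  rw [← ENNReal.ofReal_mul (Real.exp_pos _).le, ← Real.exp_add,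
    show σ * p 1 - t * p 0 = -(t * p 0) + σ * p 1 by ring]

/-- **The gap sets are null.** Under the disc-section hypothesis at all levels `t > 0`, for every
`δ > 0` and `L` the set `{0 ≤ p₀ ≤ L, p₀ + δ < |p₁|}` is `μ`-null: along the rays `t = Y + 1`,
`σ = ±Y` the exponential moments stay `≤ M`, while on the gap set
`e^{Y p₁ - t p₀} + e^{-Y p₁ - t p₀} ≥ e^{δ Y - L}`. -/
theorem measure_gapSet_eq_zero (μ : Measure (EuclideanSpace ℝ (Fin 4))) [IsFiniteMeasure μ]
    (hE : μ {p | p 0 < 0} = 0) (M : ℝ)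
    (hdisc : ∀ t : ℝ, 0 < t → ∃ f : ℂ → ℂ,
      DifferentiableOn ℂ f (Metric.ball 0 t) ∧
        (∀ z ∈ Metric.ball (0 : ℂ) t, ‖f z‖ ≤ M) ∧
          ∀ b : ℝ, |b| < t →
            f b = ∫ p, Complex.exp ((((-(t * p 0) : ℝ)) : ℂ) + ((b * p 1 : ℝ) : ℂ) * Complex.I) ∂μ)
    {δ : ℝ} (hδ : 0 < δ) (L : ℝ) :
    μ {p : EuclideanSpace ℝ (Fin 4) | 0 ≤ p 0 ∧ p 0 ≤ L ∧ p 0 + δ < |p 1|} = 0 := by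
  set A := {p : EuclideanSpace ℝ (Fin 4) | 0 ≤ p 0 ∧ p 0 ≤ L ∧ p 0 + δ < |p 1|} with hA
  -- the ray bound: for `Y > 0`, `μ A ≤ e^{L - δ Y} · 2M`
  have hray : ∀ Y : ℝ, 0 < Y →
      μ A ≤ ENNReal.ofReal (Real.exp (L - δ * Y)) * (2 * ENNReal.ofReal M) := by
    intro Y hY
    obtain ⟨f, hf, hfM, hrep⟩ := hdisc (Y + 1) (by linarith)
    have h1 := lintegral_exp_le μ hE (by linarith) hf hfM hrep (σ := Y)
      (by rw [abs_of_pos hY]; linarith)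
    have h2 := lintegral_exp_le μ hE (by linarith) hf hfM hrep (σ := -Y)
      (by rw [abs_neg, abs_of_pos hY]; linarith)
    have hsum : ∫⁻ p, (ENNReal.ofReal (Real.exp (Y * p 1 - (Y + 1) * p 0)) +
        ENNReal.ofReal (Real.exp (-Y * p 1 - (Y + 1) * p 0))) ∂μ ≤ 2 * ENNReal.ofReal M := by
      rw [lintegral_add_left (measurable_ofReal_exp Y (Y + 1)), two_mul]
      exact add_le_add h1 h2
    have hlow : ∀ p ∈ A, ENNReal.ofReal (Real.exp (δ * Y - L)) ≤
        ENNReal.ofReal (Real.exp (Y * p 1 - (Y + 1) * p 0)) +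
          ENNReal.ofReal (Real.exp (-Y * p 1 - (Y + 1) * p 0)) := by
      intro p hp
      obtain ⟨h0, hL, hgap⟩ := hp
      rcases le_or_gt 0 (p 1) with h1' | h1'
      · rw [abs_of_nonneg h1'] at hgap
        refine le_add_right (ENNReal.ofReal_le_ofReal (Real.exp_le_exp.2 ?_))
        nlinarith [mul_le_mul_of_nonneg_left hgap.le hY.le]
      · rw [abs_of_neg h1'] at hgap
        refine le_add_left (ENNReal.ofReal_le_ofReal (Real.exp_le_exp.2 ?_))
        nlinarith [mul_le_mul_of_nonneg_left hgap.le hY.le]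
    have h3 : ENNReal.ofReal (Real.exp (δ * Y - L)) * μ A ≤ 2 * ENNReal.ofReal M :=
      calc ENNReal.ofReal (Real.exp (δ * Y - L)) * μ A
          = ∫⁻ _ in A, ENNReal.ofReal (Real.exp (δ * Y - L)) ∂μ := (setLIntegral_const A _).symm
        _ ≤ ∫⁻ p in A, (ENNReal.ofReal (Real.exp (Y * p 1 - (Y + 1) * p 0)) +
              ENNReal.ofReal (Real.exp (-Y * p 1 - (Y + 1) * p 0))) ∂μ :=
            setLIntegral_mono ((measurable_ofReal_exp Y (Y + 1)).add
              (measurable_ofReal_exp (-Y) (Y + 1))) hlow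
        _ ≤ ∫⁻ p, (ENNReal.ofReal (Real.exp (Y * p 1 - (Y + 1) * p 0)) +
              ENNReal.ofReal (Real.exp (-Y * p 1 - (Y + 1) * p 0))) ∂μ :=
            setLIntegral_le_lintegral A _
        _ ≤ 2 * ENNReal.ofReal M := hsum
    have hone :
        ENNReal.ofReal (Real.exp (L - δ * Y)) * ENNReal.ofReal (Real.exp (δ * Y - L)) = 1 := by
      rw [← ENNReal.ofReal_mul (Real.exp_pos _).le, ← Real.exp_add,
        show L - δ * Y + (δ * Y - L) = 0 by ring, Real.exp_zero, ENNReal.ofReal_one]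
    calc μ A = ENNReal.ofReal (Real.exp (L - δ * Y)) *
          (ENNReal.ofReal (Real.exp (δ * Y - L)) * μ A) := by rw [← mul_assoc, hone, one_mul]
      _ ≤ ENNReal.ofReal (Real.exp (L - δ * Y)) * (2 * ENNReal.ofReal M) :=
          mul_le_mul_right h3 _
  -- the right-hand side tends to `0` as `Y → ∞`
  have hlim : Tendsto (fun Y : ℝ => ENNReal.ofReal (Real.exp (L - δ * Y)) * (2 * ENNReal.ofReal M))
      atTop (𝓝 0) := by
    have h1 : Tendsto (fun Y : ℝ => δ * Y) atTop atTop := tendsto_id.const_mul_atTop hδ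
    have h2 : Tendsto (fun Y : ℝ => Real.exp (L - δ * Y)) atTop (𝓝 0) := by
      have h := (Real.tendsto_exp_neg_atTop_nhds_zero.comp h1).const_mul (Real.exp L)
      rw [mul_zero] at h
      refine h.congr fun Y => ?_
      show Real.exp L * Real.exp (-(δ * Y)) = Real.exp (L - δ * Y)
      rw [← Real.exp_add, ← sub_eq_add_neg]
    have h3 := ENNReal.Tendsto.mul_const (b := 2 * ENNReal.ofReal M) (ENNReal.tendsto_ofReal h2)
      (Or.inr (ENNReal.mul_ne_top ENNReal.ofNat_ne_top ENNReal.ofReal_ne_top))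
    rwa [ENNReal.ofReal_zero, zero_mul] at h3
  exact nonpos_iff_eq_zero.1
    (ge_of_tendsto hlim ((eventually_gt_atTop 0).mono fun Y hY => hray Y hY))

end ConeOfDiscSections

/-- **Stub 6 · cone of disc sections** (Landau–Pringsheim; E. Lukacs, *Characteristic functions*,
Thm. 7.1.1). Let `μ` be a finite measure on `ℝ⁴` carried by `{p₀ ≥ 0}` such that, for every level
`t > 0`, the function `b ↦ ∫ e^{-t p₀ + i b p₁} dμ` on `(-t, t)` is the restriction of a function
holomorphic on the disc `|z| < t` and bounded there by the `t`-uniform constant `M`. Then `μ` is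
carried by the cone `{p₀ ≥ |p₁|}`: `μ {p₀ < |p₁|} = 0`.

Proof: the exponential moments `∫ e^{σ p₁ - t p₀} dμ ≤ M`, `|σ| < t`
(`ConeOfDiscSections.lintegral_exp_le`) kill every gap set `{0 ≤ p₀ ≤ L, p₀ + δ < |p₁|}` along
the rays `t = Y + 1`, `σ = ±Y`, `Y → ∞` (`ConeOfDiscSections.measure_gapSet_eq_zero`), and
`{p₀ < |p₁|}` is covered by `{p₀ < 0}` and the gap sets with `δ = 1/(n+1)`, `L = n + 1`. -/
theorem stub_coneOfDiscSections (μ : Measure (EuclideanSpace ℝ (Fin 4))) [IsFiniteMeasure μ]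
    (hE : μ {p | p 0 < 0} = 0) (M : ℝ)
    (hdisc : ∀ t : ℝ, 0 < t → ∃ f : ℂ → ℂ,
      DifferentiableOn ℂ f (Metric.ball 0 t) ∧
        (∀ z ∈ Metric.ball (0 : ℂ) t, ‖f z‖ ≤ M) ∧
          ∀ b : ℝ, |b| < t →
            f b = ∫ p, Complex.exp ((((-(t * p 0) : ℝ)) : ℂ) + ((b * p 1 : ℝ) : ℂ) * Complex.I) ∂μ) :
    μ {p | p 0 < |p 1|} = 0 := by
  have hA : ∀ n : ℕ,
      μ {p : EuclideanSpace ℝ (Fin 4) |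
        0 ≤ p 0 ∧ p 0 ≤ (n : ℝ) + 1 ∧ p 0 + 1 / ((n : ℝ) + 1) < |p 1|} = 0 :=
    fun n => ConeOfDiscSections.measure_gapSet_eq_zero μ hE M hdisc (by positivity) _
  have hcover : {p : EuclideanSpace ℝ (Fin 4) | p 0 < |p 1|} ⊆
      {p | p 0 < 0} ∪ ⋃ n : ℕ, {p : EuclideanSpace ℝ (Fin 4) | 0 ≤ p 0 ∧ p 0 ≤ (n : ℝ) + 1 ∧
        p 0 + 1 / ((n : ℝ) + 1) < |p 1|} := by
    intro p hp
    by_cases h0 : p 0 < 0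
    · exact Or.inl h0
    · refine Or.inr (mem_iUnion.2 ?_)
      have h0 : 0 ≤ p 0 := not_lt.1 h0
      have hgap : 0 < |p 1| - p 0 := sub_pos.2 hp
      obtain ⟨n, hn⟩ := exists_nat_gt (max (p 0) (1 / (|p 1| - p 0)))
      have hn0 : p 0 < n := (le_max_left _ _).trans_lt hn
      have hn1 : 1 / (|p 1| - p 0) < n := (le_max_right _ _).trans_lt hn
      refine ⟨n, h0, by linarith, ?_⟩
      have hlt : 1 / ((n : ℝ) + 1) < |p 1| - p 0 := by
        rw [div_lt_iff₀ hgap] at hn1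
        rw [div_lt_iff₀ (by positivity)]
        nlinarith
      linarith
  exact measure_mono_null hcover (measure_union_null hE (measure_iUnion_null hA))

end Summit.QuantumFields.YangMills.Cruxes.ShellRigidity.TransverseSmearingPlanarThreshold
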